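import Literature.Analysis.FluidPDE.ElgindiPolarSingularBounds
import Literature.Analysis.FluidPDE.ElgindiPolarWeightedEstimate
import HarnessLib

/-!
# Step 2 of Elgindi's weighted elliptic estimate: radial and weak angular weights
([Elgindi2021] §7.3, Proposition 7.7, Step 2, display (7.3))

Topic `Literature/Analysis/FluidPDE`. Proof file (everything proved, no definitions, no named
facts) on the proof path of the named fact
`Literature.Analysis.FluidPDE.Elgindi.ElgindiGhoulMasmoudi2021_stabilityCore`
(`ElgindiStabilityDecomposition.lean`). T. M. Elgindi, Ann. of Math. 194 (2021) =
arXiv:1904.04795, §7.3, proof of Proposition 7.7 (p. 21–22 of the held text):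

> "**Step 2: Radial and (weak) angular weights.** In this step we will prove
> `α²|R²∂_{RR}Ψ w/sin(2θ)^{η/2}|_{L²} + |∂_θθΨ w/sin(2θ)^{η/2}|_{L²} ≤ C₁|F w/sin(2θ)^{η/2}|_{L²}`. (7.3)
> […] `I₁ ≥ ((1−η)/(1+η))α²|R∂_{Rθ}Ψ w/sin(2θ)^{η/2}|²_{L²} − C|Fw|_{L²}√I₃`. […]
> `I₄ ≥ (sin²(θ)(∂_θΨ̄)², w²/sin^η(2θ)) − C|Fw|²_{L²}`. Summing up the estimates of `I_i` for
> `1 ≤ i ≤ 5`, we get: `|∂_θθΨ w/sin(2θ)^{η/2}|_{L²} ≤ C₁|F w/sin(2θ)^{η/2}|_{L²}`. From here, it is not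
> difficult to get (7.3)."

We prove (7.3) as an a-priori estimate in the class of Step 1 (`Ψ = cos θ·χ`, `χ ∈ C³(ℝ²)` compactly
supported inside `R > 0`, `χ(R,0) = 0`, `F := L(Ψ)` orthogonal to `sin θcos²θ` on every slice,
`0 < α ≤ 1/4`), with `w² = (1+R)⁴/R⁴`, `η = 99/100` and explicit (non-optimized) universal
constants, from the exact identity of `ElgindiPolarEnergyTwoSingular.lean`, the lower-order bounds of
`ElgindiPolarSingularBounds.lean` (Hardy, sharp Hardy with the margin `(1−η)/(1+η) = 1/199`, and the
elementary embedding for the `sec(θ)Ψ`-terms), Step 1 (`ElgindiPolarWeightedEstimate.lean`) and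
Cauchy–Schwarz: with `L = ‖F w sin(2θ)^{−η/2}‖²`,

  `‖∂_θθΨ w s^{−η/2}‖² ≤ 42000 L`, `α²‖R∂_{Rθ}Ψ w s^{−η/2}‖² ≤ 4200000 L`, `‖∂_θχ w s^{−η/2}‖² ≤ 21000 L`,
  `α⁴‖R²∂_{RR}Ψ w s^{−η/2}‖² ≤ 440000 L`

together with the auxiliary bounds on `α²‖R∂_RΨ·‖²`, `‖Ψ·‖²`, `‖χ·‖²`, `‖∂_θΨ·‖²`
(`polar_singular_apriori_estimate`).
-/

noncomputable section

open MeasureTheory Set Real Filter Function intervalIntegral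
open _root_.Topology

namespace Literature.Analysis.FluidPDE

namespace Elgindi

/-! ### Real-variable tools -/

/-- **Weighted Cauchy–Schwarz, squared form**: `(∫φψρ)² ≤ (∫φ²ρ)(∫ψ²ρ)` for an a.e. nonnegative
weight `ρ`. [folklore] -/
theorem sq_integral_mul_mul_le {X : Type*} [MeasurableSpace X] {μ : Measure X} {φ ψ ρ : X → ℝ}
    (hρ : ∀ᵐ x ∂μ, 0 ≤ ρ x) (hφ : Integrable (fun x => φ x ^ 2 * ρ x) μ) (hψ : Integrable (fun x => ψ x ^ 2 * ρ x) μ)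
    (hφψ : Integrable (fun x => φ x * ψ x * ρ x) μ) :
    (∫ x, φ x * ψ x * ρ x ∂μ) ^ 2 ≤ (∫ x, φ x ^ 2 * ρ x ∂μ) * ∫ x, ψ x ^ 2 * ρ x ∂μ := by
  have e1 : (fun x => (φ x * Real.sqrt (ρ x)) ^ 2) =ᵐ[μ] fun x => φ x ^ 2 * ρ x := by
    filter_upwards [hρ] with x hx
    rw [mul_pow, Real.sq_sqrt hx]
  have e2 : (fun x => (ψ x * Real.sqrt (ρ x)) ^ 2) =ᵐ[μ] fun x => ψ x ^ 2 * ρ x := by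
    filter_upwards [hρ] with x hx
    rw [mul_pow, Real.sq_sqrt hx]
  have e3 : (fun x => (φ x * Real.sqrt (ρ x)) * (ψ x * Real.sqrt (ρ x))) =ᵐ[μ] fun x => φ x * ψ x * ρ x := by
    filter_upwards [hρ] with x hx
    have := Real.mul_self_sqrt hx
    calc (φ x * Real.sqrt (ρ x)) * (ψ x * Real.sqrt (ρ x)) = φ x * ψ x * (Real.sqrt (ρ x) * Real.sqrt (ρ x)) := by ring
      _ = _ := by rw [this]
  have h := sq_integral_mul_le (μ := μ) (φ := fun x => φ x * Real.sqrt (ρ x)) (ψ := fun x => ψ x * Real.sqrt (ρ x))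
    (hφ.congr e1.symm) (hψ.congr e2.symm) (hφψ.congr e3.symm)
  rw [integral_congr_ae e1, integral_congr_ae e2, integral_congr_ae e3] at h
  exact h

/-- From `I² ≤ cLP` (`L, P, c ≥ 0`, `ε > 0`): `|I| ≤ εP + (c/(4ε))L`. [folklore] -/
theorem abs_le_of_sq_le_mul_young {I c L P ε : ℝ} (hc : 0 ≤ c) (hL : 0 ≤ L) (hP : 0 ≤ P) (hε : 0 < ε)
    (h : I ^ 2 ≤ c * L * P) : |I| ≤ ε * P + c / (4 * ε) * L := by
  have hR : 0 ≤ ε * P + c / (4 * ε) * L := by positivity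
  have hsq : I ^ 2 ≤ (ε * P + c / (4 * ε) * L) ^ 2 := by
    have e : (ε * P + c / (4 * ε) * L) ^ 2 = (ε * P - c / (4 * ε) * L) ^ 2 + c * L * P := by
      field_simp; ring
    nlinarith [sq_nonneg (ε * P - c / (4 * ε) * L)]
  by_contra hlt
  have hlt' : ε * P + c / (4 * ε) * L < |I| := not_le.1 hlt
  have := pow_lt_pow_left₀ hlt' hR two_ne_zero
  rw [sq_abs] at this
  linarith

/-- The bookkeeping of Step 2 at `η = 99/100` (margin `1 − 2η/(1+η) = 1/199`). [folklore] -/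
theorem step2_algebra {e P Z Q I0 TA1 B E5 A A4 X1 Xc X4 Y Xχ L : ℝ} (he : e = 99 / 100)
    (hP : 0 ≤ P) (hZ : 0 ≤ Z) (hQ : 0 ≤ Q) (hL : 0 ≤ L) (hX4nn : 0 ≤ X4)
    (hid : P + Z + Q = I0 + TA1 + 2 * e * A + 2 * e * (1 + e) * A4 - B - (1 - 2 * e) * X1 + (1 / 2) * (1 + e) * Xc +
      2 * e * (1 + e) * X4 - 6 * E5)
    (hI0 : I0 ^ 2 ≤ L * P) (hTA1 : TA1 ^ 2 ≤ 30 * L * P) (hB : B ^ 2 ≤ 3308 * L * P) (hE5 : E5 ^ 2 ≤ X1 * P)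
    (hA : A ≤ 120 * L) (hA4 : (1 + e) ^ 2 * A4 ≤ Z) (hX1 : X1 ≤ 10 * L) (hXc : |Xc| ≤ Xχ) (hXχ : Xχ ≤ 4748 * L)
    (hX4 : (1 + e) ^ 2 * X4 ≤ Y) (hY : Y ≤ 6322 * L) :
    P ≤ 42000 * L ∧ Z ≤ 4200000 * L ∧ Q ≤ 21000 * L := by
  subst he
  have hε : (0 : ℝ) < 1 / 8 := by norm_num
  have a0 := abs_le_of_sq_le_mul_young zero_le_one hL hP hε (by linarith : I0 ^ 2 ≤ 1 * L * P)
  have a1 := abs_le_of_sq_le_mul_young (by norm_num : (0 : ℝ) ≤ 30) hL hP hε hTA1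
  have a2 := abs_le_of_sq_le_mul_young (by norm_num : (0 : ℝ) ≤ 3308) hL hP hε hB
  have hE5' : (6 * E5) ^ 2 ≤ 360 * L * P := by nlinarith [mul_le_mul_of_nonneg_right hX1 hP]
  have a5 := abs_le_of_sq_le_mul_young (by norm_num : (0 : ℝ) ≤ 360) hL hP hε hE5'
  have b0 := le_abs_self I0
  have b1 := le_abs_self TA1
  have b2 := neg_abs_le B
  have b5 := neg_abs_le (6 * E5)
  have c2 := le_abs_self Xc
  have hYnn : 0 ≤ Y := le_trans (mul_nonneg (sq_nonneg _) hX4nn) hX4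
  -- the key linear inequality `P/2 + Z/199 + Q ≤ 18692 L`
  have key : P / 2 + Z / 199 + Q ≤ 18692 * L := by
    linarith [a0, a1, a2, a5, b0, b1, b2, b5, c2, hid, hA4, hX4, hA, hX1, hXχ, hXc, hY, hYnn]
  refine ⟨by linarith, by linarith, by linarith⟩

/-- `|∂_R(R²w²)| ≤ 2Rw²` on `R > 0` (`∂_R(R²w²) = 2(1+R)³(R−1)/R³`, `Rw² = (1+R)⁴/R³`). [folklore] -/
theorem abs_deriv_sq_mul_radialWeight_sq_le {R : ℝ} (hR : 0 < R) :
    |deriv (fun R : ℝ => R ^ 2 * radialWeight R ^ 2) R| ≤ 2 * R * radialWeight R ^ 2 := by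
  rw [(hasDerivAt_sq_mul_radialWeight_sq hR).deriv, mul_assoc, mul_radialWeight_sq hR.ne', abs_div,
    abs_of_pos (pow_pos hR 3), abs_mul, abs_of_pos (pow_pos (by linarith : (0 : ℝ) < 1 + R) 3), mul_div_assoc']
  refine div_le_div_of_nonneg_right ?_ (by positivity)
  have h3 : |2 * R - 2| ≤ 2 * (1 + R) := by
    rw [abs_le]; constructor <;> linarith
  calc (1 + R) ^ 3 * |2 * R - 2| ≤ (1 + R) ^ 3 * (2 * (1 + R)) := mul_le_mul_of_nonneg_left h3 (by positivity)
    _ = 2 * (1 + R) ^ 4 := by ring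

/-- The complete bookkeeping of Step 2 on named reals (all constants explicit). [folklore] -/
theorem step2_final {α e I0 T1 Z A A4 B P X1 Xc Q X4 E L L0 J Xχ Y Q1 RR : ℝ} (he : e = 99 / 100)
    (hα : 0 < α) (hα4 : α ≤ 1 / 4)
    (hId : I0 = α ^ 2 * (-T1 + Z - 2 * e * A - 2 * e * (1 + e) * A4) + α * (5 + α) * B + P +
      ((1 - 2 * e) * X1 - (1 / 2) * (1 + e) * Xc + Q - 2 * e * (1 + e) * X4) + 6 * E)
    (hCS0 : I0 ^ 2 ≤ L * P) (hCS1 : J ^ 2 ≤ A * P) (hCS2 : B ^ 2 ≤ A * P) (hCS3 : E ^ 2 ≤ X1 * P)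
    (hT1 : |T1| ≤ 2 * J) (hA : α ^ 2 * A ≤ 120 * L0) (hX1 : X1 ≤ 10 * L0) (hXχ : Xχ ≤ 4748 * L0) (hY : Y ≤ 6322 * L0)
    (hB5 : (1 + e) ^ 2 * A4 ≤ Z) (hB6 : (1 + e) ^ 2 * X4 ≤ Y) (hX2 : |Xc| ≤ Xχ) (hQ1 : Q1 ≤ Q) (hL0L : L0 ≤ L)
    (hLnn : 0 ≤ L) (hPnn : 0 ≤ P) (hZnn : 0 ≤ Z) (hX4nn : 0 ≤ X4) (hQ1nn : 0 ≤ Q1)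
    (hmono : α ^ 4 * RR ≤ 6 * (L + 36 * (α ^ 2 * A) + P + Xχ + Q1 + 36 * X1)) :
    P ≤ 42000 * L ∧ α ^ 2 * Z ≤ 4200000 * L ∧ Q1 ≤ 21000 * L ∧ α ^ 2 * A ≤ 120 * L ∧ X1 ≤ 10 * L ∧
      Xχ ≤ 4748 * L ∧ Y ≤ 6322 * L ∧ α ^ 4 * RR ≤ 440000 * L := by
  have hα2 : α ^ 2 ≤ 1 / 16 := by
    calc α ^ 2 = α * α := sq α
      _ ≤ (1 / 4) * (1 / 4) := mul_le_mul hα4 hα4 hα.le (by norm_num)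
      _ = 1 / 16 := by norm_num
  have hA' : α ^ 2 * A ≤ 120 * L := hA.trans (by linarith)
  have hX1' : X1 ≤ 10 * L := hX1.trans (by linarith)
  have hXχ' : Xχ ≤ 4748 * L := hXχ.trans (by linarith)
  have hY' : Y ≤ 6322 * L := hY.trans (by linarith)
  have u2 : α ^ 2 * A * P ≤ 120 * L * P := mul_le_mul_of_nonneg_right hA' hPnn
  -- `(α²T1)² ≤ 30 L P`
  have t1 : T1 ^ 2 ≤ 4 * (A * P) := by
    have h := abs_le.1 hT1
    nlinarith [h.1, h.2, hCS1]
  have hTA1sq : (α ^ 2 * T1) ^ 2 ≤ 30 * L * P := by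
    have u1 : (α ^ 2) ^ 2 * T1 ^ 2 ≤ (α ^ 2) ^ 2 * (4 * (A * P)) := mul_le_mul_of_nonneg_left t1 (sq_nonneg _)
    have u3 : 4 * α ^ 2 * (α ^ 2 * A * P) ≤ 4 * α ^ 2 * (120 * L * P) := mul_le_mul_of_nonneg_left u2 (by positivity)
    have hLP : 0 ≤ 120 * L * P := by positivity
    have u4 : 4 * α ^ 2 * (120 * L * P) ≤ 4 * (1 / 16) * (120 * L * P) :=
      mul_le_mul_of_nonneg_right (mul_le_mul_of_nonneg_left hα2 (by norm_num)) hLP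
    calc (α ^ 2 * T1) ^ 2 = (α ^ 2) ^ 2 * T1 ^ 2 := by ring
      _ ≤ (α ^ 2) ^ 2 * (4 * (A * P)) := u1
      _ = 4 * α ^ 2 * (α ^ 2 * A * P) := by ring
      _ ≤ 4 * α ^ 2 * (120 * L * P) := u3
      _ ≤ 4 * (1 / 16) * (120 * L * P) := u4
      _ = 30 * L * P := by ring
  -- `(α(5+α)B)² ≤ 3308 L P`
  have hBsq : (α * (5 + α) * B) ^ 2 ≤ 3308 * L * P := by
    have h5 : (5 + α) ^ 2 ≤ 441 / 16 := by nlinarith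
    have s1 : α ^ 2 * B ^ 2 ≤ α ^ 2 * A * P := by
      have := mul_le_mul_of_nonneg_left hCS2 (sq_nonneg α); linarith [this]
    have s2 : α ^ 2 * B ^ 2 ≤ 120 * L * P := s1.trans u2
    have s3 : (5 + α) ^ 2 * (α ^ 2 * B ^ 2) ≤ 441 / 16 * (120 * L * P) :=
      mul_le_mul h5 s2 (mul_nonneg (sq_nonneg _) (sq_nonneg _)) (by norm_num)
    have hLP : 0 ≤ L * P := mul_nonneg hLnn hPnn
    calc (α * (5 + α) * B) ^ 2 = (5 + α) ^ 2 * (α ^ 2 * B ^ 2) := by ring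
      _ ≤ 441 / 16 * (120 * L * P) := s3
      _ ≤ 3308 * L * P := by linarith [hLP]
  have hA4' : (1 + e) ^ 2 * (α ^ 2 * A4) ≤ α ^ 2 * Z := by
    have := mul_le_mul_of_nonneg_left hB5 (sq_nonneg α); linarith [this]
  have hid : P + α ^ 2 * Z + Q = I0 + α ^ 2 * T1 + 2 * e * (α ^ 2 * A) + 2 * e * (1 + e) * (α ^ 2 * A4) -
      α * (5 + α) * B - (1 - 2 * e) * X1 + (1 / 2) * (1 + e) * Xc + 2 * e * (1 + e) * X4 - 6 * E := by
    linear_combination (-1 : ℝ) * hId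
  obtain ⟨hPfin, hZfin, hQfin⟩ := step2_algebra he hPnn (mul_nonneg (sq_nonneg α) hZnn) (hQ1nn.trans hQ1) hLnn
    hX4nn hid hCS0 hTA1sq hBsq hCS3 hA' hA4' hX1' hX2 hXχ' hB6 hY'
  refine ⟨hPfin, hZfin, hQ1.trans hQfin, hA', hX1', hXχ', hY', ?_⟩
  have hQ1fin : Q1 ≤ 21000 * L := hQ1.trans hQfin
  linarith [hmono, hA', hPfin, hXχ', hQ1fin, hX1']

/-! ### The estimate -/

set_option maxHeartbeats 1600000 in
/-- **Proposition 7.7, Step 2 (display (7.3)), a-priori form with explicit constants.** For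
`0 < α ≤ 1/4`, `Ψ = cos θ·χ` with `χ ∈ C³(ℝ²)` compactly supported inside `R > 0` and `χ(R,0) = 0`,
and `F := L(Ψ)` orthogonal to `sin θcos²θ` on every slice, with `w² = (1+R)⁴/R⁴`, `u = sin(2θ)^{−η}`,
`η = 99/100` and `L = ∫∫ w² u F²`: `∫∫ w²u(∂_θθΨ)² ≤ 42000L`, `α²∫∫ R²w²u(∂_{Rθ}Ψ)² ≤ 4200000L`,
`∫∫ w²u(∂_θχ)² ≤ 21000L`, `α²∫∫ R²w²u(∂_RΨ)² ≤ 120L`, `∫∫ w²uΨ² ≤ 10L`, `∫∫ w²uχ² ≤ 4748L`,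
`∫∫ w²u(∂_θΨ)² ≤ 6322L`, `α⁴∫∫ w²u(R²∂_{RR}Ψ)² ≤ 440000L`.
[cite: Elgindi2021, §7.3 Proposition 7.7, proof, Step 2, display (7.3) (pp. 21–22 of arXiv:1904.04795)] -/
theorem polar_singular_apriori_estimate {α : ℝ} (hα : 0 < α) (hα4 : α ≤ 1 / 4) {χ : ℝ → ℝ → ℝ}
    (hχ : ContDiff ℝ 3 (uncurry χ)) (hs : HasCompactSupport (uncurry χ)) (hpos : ∀ p ∈ tsupport (uncurry χ), 0 < p.1)
    (hχ0 : ∀ R, χ R 0 = 0) {Ψ : ℝ → ℝ → ℝ} (hΨ : Ψ = fun R θ => Real.cos θ * χ R θ)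
    (horth : ∀ R, 0 < R → ∫ θ in Ioo 0 (π / 2), ellipticOp α Ψ R θ * kernelK θ = 0) :
    (∫ p in strip, radialWeight p.1 ^ 2 * dθ (dθ Ψ) p.1 p.2 ^ 2 * Real.sin (2 * p.2) ^ (-eta)) ≤
        42000 * ∫ p in strip, radialWeight p.1 ^ 2 * ellipticOp α Ψ p.1 p.2 ^ 2 * Real.sin (2 * p.2) ^ (-eta) ∧
    α ^ 2 * (∫ p in strip, p.1 ^ 2 * radialWeight p.1 ^ 2 * dz (dθ Ψ) p.1 p.2 ^ 2 * Real.sin (2 * p.2) ^ (-eta)) ≤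
        4200000 * ∫ p in strip, radialWeight p.1 ^ 2 * ellipticOp α Ψ p.1 p.2 ^ 2 * Real.sin (2 * p.2) ^ (-eta) ∧
    (∫ p in strip, radialWeight p.1 ^ 2 * dθ χ p.1 p.2 ^ 2 * Real.sin (2 * p.2) ^ (-eta)) ≤
        21000 * ∫ p in strip, radialWeight p.1 ^ 2 * ellipticOp α Ψ p.1 p.2 ^ 2 * Real.sin (2 * p.2) ^ (-eta) ∧
    α ^ 2 * (∫ p in strip, p.1 ^ 2 * radialWeight p.1 ^ 2 * dz Ψ p.1 p.2 ^ 2 * Real.sin (2 * p.2) ^ (-eta)) ≤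
        120 * ∫ p in strip, radialWeight p.1 ^ 2 * ellipticOp α Ψ p.1 p.2 ^ 2 * Real.sin (2 * p.2) ^ (-eta) ∧
    (∫ p in strip, radialWeight p.1 ^ 2 * Ψ p.1 p.2 ^ 2 * Real.sin (2 * p.2) ^ (-eta)) ≤
        10 * ∫ p in strip, radialWeight p.1 ^ 2 * ellipticOp α Ψ p.1 p.2 ^ 2 * Real.sin (2 * p.2) ^ (-eta) ∧
    (∫ p in strip, radialWeight p.1 ^ 2 * χ p.1 p.2 ^ 2 * Real.sin (2 * p.2) ^ (-eta)) ≤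
        4748 * ∫ p in strip, radialWeight p.1 ^ 2 * ellipticOp α Ψ p.1 p.2 ^ 2 * Real.sin (2 * p.2) ^ (-eta) ∧
    (∫ p in strip, radialWeight p.1 ^ 2 * dθ Ψ p.1 p.2 ^ 2 * Real.sin (2 * p.2) ^ (-eta)) ≤
        6322 * ∫ p in strip, radialWeight p.1 ^ 2 * ellipticOp α Ψ p.1 p.2 ^ 2 * Real.sin (2 * p.2) ^ (-eta) ∧
    α ^ 4 * (∫ p in strip, radialWeight p.1 ^ 2 * (p.1 ^ 2 * dz (dz Ψ) p.1 p.2) ^ 2 * Real.sin (2 * p.2) ^ (-eta)) ≤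
        440000 * ∫ p in strip, radialWeight p.1 ^ 2 * ellipticOp α Ψ p.1 p.2 ^ 2 * Real.sin (2 * p.2) ^ (-eta) := by
  have hη0 : 0 ≤ eta := eta_pos.le
  have hη1 : eta < 1 := by norm_num [eta]
  have heta : eta = 99 / 100 := rfl
  have hα1 : α ≤ 1 := by linarith
  -- the radial weight
  have hWd : ContDiffOn ℝ 2 (fun R => radialWeight R ^ 2) (Ioi 0) := contDiffOn_radialWeight_sq
  have hW1 : ContDiffOn ℝ 1 (fun R => radialWeight R ^ 2) (Ioi 0) := hWd.of_le (by norm_num)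
  have hWc : ContinuousOn (fun R => radialWeight R ^ 2) (Ioi 0) := hWd.continuousOn
  have hW0 : ∀ R, 0 < R → 0 ≤ (fun R => radialWeight R ^ 2) R := fun R _ => sq_nonneg _
  have hMc : ContinuousOn (fun R => R ^ 2 * radialWeight R ^ 2) (Ioi 0) := (continuousOn_id.pow 2).mul hWc
  -- Step 1
  obtain ⟨hS1, hS2, hS3, hS4, hS5, hS6, hS7, hS8⟩ := polar_weighted_apriori_estimate hα hα4 hχ hs hpos hχ0 hΨ horth
  -- the identity of Step 2
  have hId := integral_strip_ellipticOp_mul_neg_dθdθ_singular α hη0 hη1 hW1 hχ hs hpos hχ0 hΨ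
  -- the lower-order bounds
  have hB1 := integral_strip_sq_rpow_le_ten_dθ hη0 hη1 hWc hW0 hχ hs hpos hχ0 hΨ
  have hB2 := integral_strip_dz_sq_rpow_le_ten hη0 hη1 hWc hW0 hχ hs hpos hχ0 hΨ
  have hB3 := integral_strip_chi_sq_rpow_le hη0 hη1 hWc hW0 hχ hs hpos
  have hB4 := integral_strip_dθ_sq_rpow_le hη0 hη1 hWc hW0 hχ hs hpos hΨ
  have hB5 := integral_strip_sharpHardy_dz hη0 hη1 hWc hW0 hχ hs hpos hχ0 hΨ
  have hB6 := integral_strip_sharpHardy hη0 hη1 hWc hW0 hχ hs hpos hχ0 hΨ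
  simp only at hB1 hB2 hB3 hB4 hB5 hB6 hW0
  ----------------------------------------------------------------
  -- regularity, support, the continuous representative of `F`
  ----------------------------------------------------------------
  have hχ2 : ContDiff ℝ 2 (uncurry χ) := hχ.of_le (by norm_num)
  have hχ1 : ContDiff ℝ 1 (uncurry χ) := hχ.of_le (by norm_num)
  have hΨ3 : ContDiff ℝ 3 (uncurry Ψ) := by rw [hΨ]; exact contDiff_cosProfile hχ
  have hΨ2 : ContDiff ℝ 2 (uncurry Ψ) := hΨ3.of_le (by norm_num)
  have hΨs : HasCompactSupport (uncurry Ψ) := by rw [hΨ]; exact hasCompactSupport_cosProfile hs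
  have hdzΨ : ContDiff ℝ 2 (uncurry (dz Ψ)) := contDiff_dz_of_contDiff (n := 2) hΨ3
  have hdz2Ψ : ContDiff ℝ 1 (uncurry (dz (dz Ψ))) := contDiff_dz_of_contDiff (n := 1) hdzΨ
  have hdθΨ : ContDiff ℝ 2 (uncurry (dθ Ψ)) := contDiff_dθ_of_contDiff (n := 2) hΨ3
  have hdθ2Ψ : ContDiff ℝ 1 (uncurry (dθ (dθ Ψ))) := contDiff_dθ_of_contDiff (n := 1) hdθΨ
  have hdzdθΨ : ContDiff ℝ 1 (uncurry (dz (dθ Ψ))) := contDiff_dz_of_contDiff (n := 1) hdθΨ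
  have hdθχ : ContDiff ℝ 2 (uncurry (dθ χ)) := contDiff_dθ_of_contDiff (n := 2) hχ
  have hdzΨs : HasCompactSupport (uncurry (dz Ψ)) := hasCompactSupport_dz hΨs
  have hdz2Ψs : HasCompactSupport (uncurry (dz (dz Ψ))) := hasCompactSupport_dz hdzΨs
  have hdθΨs : HasCompactSupport (uncurry (dθ Ψ)) := hasCompactSupport_dθ_of hΨs
  have hdθ2Ψs : HasCompactSupport (uncurry (dθ (dθ Ψ))) := hasCompactSupport_dθ_of hdθΨs
  have hdzdθΨs : HasCompactSupport (uncurry (dz (dθ Ψ))) := hasCompactSupport_dz hdθΨs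
  have hdθχs : HasCompactSupport (uncurry (dθ χ)) := hasCompactSupport_dθ_of hs
  have cχ : Continuous fun p : ℝ × ℝ => χ p.1 p.2 := hχ.continuous
  have cΨ : Continuous fun p : ℝ × ℝ => Ψ p.1 p.2 := hΨ3.continuous
  have cdz : Continuous fun p : ℝ × ℝ => dz Ψ p.1 p.2 := hdzΨ.continuous
  have cdz2 : Continuous fun p : ℝ × ℝ => dz (dz Ψ) p.1 p.2 := hdz2Ψ.continuous
  have cdθ : Continuous fun p : ℝ × ℝ => dθ Ψ p.1 p.2 := hdθΨ.continuous
  have cdθ2 : Continuous fun p : ℝ × ℝ => dθ (dθ Ψ) p.1 p.2 := hdθ2Ψ.continuous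
  have cdzdθ : Continuous fun p : ℝ × ℝ => dz (dθ Ψ) p.1 p.2 := hdzdθΨ.continuous
  have cdθχ : Continuous fun p : ℝ × ℝ => dθ χ p.1 p.2 := hdθχ.continuous
  obtain ⟨a, ha, hva⟩ := exists_pos_forall_fst_lt_eq_zero hs hpos
  have hvaχ : ∀ p : ℝ × ℝ, p.1 < a → χ p.1 p.2 = 0 := fun p hp => hva p hp
  have hvaΨ : ∀ p : ℝ × ℝ, p.1 < a → Ψ p.1 p.2 = 0 := fun p hp => by rw [hΨ]; simp [hvaχ p hp]
  have vanish_dz : ∀ (G : ℝ → ℝ → ℝ), (∀ p : ℝ × ℝ, p.1 < a → G p.1 p.2 = 0) → ∀ p : ℝ × ℝ, p.1 < a → dz G p.1 p.2 = 0 := by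
    intro G hG p hp
    show deriv (fun R' => G R' p.2) p.1 = 0
    have : (fun R' => G R' p.2) =ᶠ[𝓝 p.1] fun _ => 0 :=
      Filter.eventuallyEq_of_mem (Iio_mem_nhds hp) fun R' hR' => hG (R', p.2) hR'
    rw [this.deriv_eq, deriv_const]
  have vanish_dθ : ∀ (G : ℝ → ℝ → ℝ), (∀ p : ℝ × ℝ, p.1 < a → G p.1 p.2 = 0) → ∀ p : ℝ × ℝ, p.1 < a → dθ G p.1 p.2 = 0 := by
    intro G hG p hp
    show deriv (fun θ' => G p.1 θ') p.2 = 0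
    have : (fun θ' => G p.1 θ') = fun _ => 0 := funext fun θ' => hG (p.1, θ') hp
    rw [this, deriv_const]
  have hvadz : ∀ p : ℝ × ℝ, p.1 < a → dz Ψ p.1 p.2 = 0 := vanish_dz Ψ hvaΨ
  have hvadz2 : ∀ p : ℝ × ℝ, p.1 < a → dz (dz Ψ) p.1 p.2 = 0 := vanish_dz (dz Ψ) hvadz
  have hvadθ : ∀ p : ℝ × ℝ, p.1 < a → dθ Ψ p.1 p.2 = 0 := vanish_dθ Ψ hvaΨ
  have hvadθ2 : ∀ p : ℝ × ℝ, p.1 < a → dθ (dθ Ψ) p.1 p.2 = 0 := vanish_dθ (dθ Ψ) hvadθ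
  have hvadθχ : ∀ p : ℝ × ℝ, p.1 < a → dθ χ p.1 p.2 = 0 := vanish_dθ χ hvaχ
  have hsin : ∀ p ∈ strip, 0 < Real.sin (2 * p.2) := fun p hp =>
    Real.sin_pos_of_pos_of_lt_pi (by linarith [hp.2.1]) (by linarith [hp.2.2])
  -- the continuous representative of `F = L(Ψ)` on the strip
  obtain ⟨G, hG⟩ : ∃ G : ℝ × ℝ → ℝ, G = fun p => -α ^ 2 * p.1 ^ 2 * dz (dz Ψ) p.1 p.2 - α * (5 + α) * p.1 * dz Ψ p.1 p.2 -
      dθ (dθ Ψ) p.1 p.2 + (Real.cos p.2 * χ p.1 p.2 + Real.sin p.2 * dθ χ p.1 p.2) - 6 * Ψ p.1 p.2 := ⟨_, rfl⟩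
  have cG : Continuous G := by rw [hG]; fun_prop
  have hGa : ∀ p : ℝ × ℝ, p.1 < a → G p = 0 := fun p hp => by
    rw [hG]; simp [hvadz2 p hp, hvadz p hp, hvadθ2 p hp, hvaχ p hp, hvadθχ p hp, hvaΨ p hp]
  have sG : HasCompactSupport G := by
    refine HasCompactSupport.of_support_subset_isCompact
      ((((hdz2Ψs.isCompact.union hdzΨs.isCompact).union hdθ2Ψs.isCompact).union (hs.isCompact.union hdθχs.isCompact)).union hΨs.isCompact)
      fun p hp => ?_
    by_contra h
    simp only [mem_union, not_or] at h
    obtain ⟨⟨⟨⟨h1, h2⟩, h3⟩, ⟨h4, h5⟩⟩, h6⟩ := h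
    have z1 : dz (dz Ψ) p.1 p.2 = 0 := by have := image_eq_zero_of_notMem_tsupport h1; exact this
    have z2 : dz Ψ p.1 p.2 = 0 := by have := image_eq_zero_of_notMem_tsupport h2; exact this
    have z3 : dθ (dθ Ψ) p.1 p.2 = 0 := by have := image_eq_zero_of_notMem_tsupport h3; exact this
    have z4 : χ p.1 p.2 = 0 := by have := image_eq_zero_of_notMem_tsupport h4; exact this
    have z5 : dθ χ p.1 p.2 = 0 := by have := image_eq_zero_of_notMem_tsupport h5; exact this
    have z6 : Ψ p.1 p.2 = 0 := by have := image_eq_zero_of_notMem_tsupport h6; exact this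
    apply hp
    rw [hG]; simp [z1, z2, z3, z4, z5, z6]
  have hFG : ∀ p ∈ strip, ellipticOp α Ψ p.1 p.2 = G p := by
    intro p hp
    have hcos : Real.cos p.2 ≠ 0 := (Real.cos_pos_of_mem_Ioo ⟨by linarith [hp.2.1, Real.pi_pos], hp.2.2⟩).ne'
    have hΨp : Ψ p.1 p.2 = Real.cos p.2 * χ p.1 p.2 := by rw [hΨ]
    have hT : Ψ p.1 p.2 / Real.cos p.2 ^ 2 +
        Real.sin p.2 * (-Real.sin p.2 * χ p.1 p.2 + Real.cos p.2 * dθ χ p.1 p.2) / Real.cos p.2 =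
        Real.cos p.2 * χ p.1 p.2 + Real.sin p.2 * dθ χ p.1 p.2 := by
      rw [hΨp, div_add_div _ _ (pow_ne_zero 2 hcos) hcos, div_eq_iff (mul_ne_zero (pow_ne_zero 2 hcos) hcos)]
      have := Real.sin_sq_add_cos_sq p.2
      linear_combination (-(Real.cos p.2 ^ 2 * χ p.1 p.2)) * this
    have hdθp : dθ Ψ p.1 p.2 = -Real.sin p.2 * χ p.1 p.2 + Real.cos p.2 * dθ χ p.1 p.2 := by rw [hΨ, dθ_cosProfile hχ1]
    have hud : DifferentiableAt ℝ (fun θ' => Ψ p.1 θ') p.2 :=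
      ((hΨ2.comp (contDiff_const.prodMk contDiff_id)).differentiable (by simp)) p.2
    have hGp : G p = -α ^ 2 * p.1 ^ 2 * dz (dz Ψ) p.1 p.2 - α * (5 + α) * p.1 * dz Ψ p.1 p.2 -
        dθ (dθ Ψ) p.1 p.2 + (Real.cos p.2 * χ p.1 p.2 + Real.sin p.2 * dθ χ p.1 p.2) - 6 * Ψ p.1 p.2 := by rw [hG]
    rw [hGp, ellipticOp_eq_expanded α hud hcos, hdθp, hT]
  -- generic integrability tools
  have int2 : ∀ (H : ℝ × ℝ → ℝ), Continuous H → HasCompactSupport H →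
      IntegrableOn (fun p : ℝ × ℝ => H p * Real.sin (2 * p.2) ^ (-eta)) strip :=
    fun H hH hHs => integrableOn_strip_mul_rpow_of_continuous hη0 hη1 hH hHs
  have supp_of : ∀ (Fn : ℝ × ℝ → ℝ) (g : ℝ × ℝ → ℝ), HasCompactSupport g → (∀ p, g p = 0 → Fn p = 0) → HasCompactSupport Fn :=
    fun Fn g hg h => hg.mono fun p hp => by
      contrapose! hp
      simp only [mem_support, ne_eq, not_not] at hp ⊢
      exact h p hp
  -- `W·(plane function)` integrands: continuity with compact support
  have cW_of : ∀ (g : ℝ × ℝ → ℝ), Continuous g → (∀ p : ℝ × ℝ, p.1 < a → g p = 0) →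
      Continuous fun p : ℝ × ℝ => radialWeight p.1 ^ 2 * g p :=
    fun g hg hga => continuous_weight_mul₂ hWc hg ha hga
  ----------------------------------------------------------------
  -- the named quantities (strip integrals)
  ----------------------------------------------------------------
  -- L, L₀
  have eL : ∫ p in strip, radialWeight p.1 ^ 2 * ellipticOp α Ψ p.1 p.2 ^ 2 * Real.sin (2 * p.2) ^ (-eta) =
      ∫ p in strip, radialWeight p.1 ^ 2 * G p ^ 2 * Real.sin (2 * p.2) ^ (-eta) :=
    setIntegral_congr_fun measurableSet_strip fun p hp => by rw [hFG p hp]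
  have eL0 : ∫ p in strip, radialWeight p.1 ^ 2 * ellipticOp α Ψ p.1 p.2 ^ 2 = ∫ p in strip, radialWeight p.1 ^ 2 * G p ^ 2 :=
    setIntegral_congr_fun measurableSet_strip fun p hp => by rw [hFG p hp]
  rw [eL0] at hS1 hS2 hS3 hS4 hS5 hS6 hS7 hS8
  rw [eL]
  have hL0L : ∫ p in strip, radialWeight p.1 ^ 2 * G p ^ 2 ≤ ∫ p in strip, radialWeight p.1 ^ 2 * G p ^ 2 * Real.sin (2 * p.2) ^ (-eta) :=
    integral_strip_le_rpow hη0 hη1 hWc (fun R _ => sq_nonneg _) cG sG ha hGa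
  have hL0nn : 0 ≤ ∫ p in strip, radialWeight p.1 ^ 2 * G p ^ 2 := integral_nonneg fun p => by positivity
  -- nonnegativity of the `u`-weighted quantities
  have nn_of : ∀ (g : ℝ × ℝ → ℝ), 0 ≤ ∫ p in strip, radialWeight p.1 ^ 2 * g p ^ 2 * Real.sin (2 * p.2) ^ (-eta) :=
    fun g => setIntegral_nonneg measurableSet_strip fun p hp => mul_nonneg (by positivity) (Real.rpow_nonneg (hsin p hp).le _)
  have nnM_of : ∀ (g : ℝ × ℝ → ℝ), 0 ≤ ∫ p in strip, p.1 ^ 2 * radialWeight p.1 ^ 2 * g p ^ 2 * Real.sin (2 * p.2) ^ (-eta) :=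
    fun g => setIntegral_nonneg measurableSet_strip fun p hp => mul_nonneg (by positivity) (Real.rpow_nonneg (hsin p hp).le _)
  have hLnn := nn_of G
  have hPnn := nn_of (fun p => dθ (dθ Ψ) p.1 p.2)
  have hZnn := nnM_of (fun p => dz (dθ Ψ) p.1 p.2)
  have hAnn := nnM_of (fun p => dz Ψ p.1 p.2)
  have hX1nn := nn_of (fun p => Ψ p.1 p.2)
  have hQ1nn := nn_of (fun p => dθ χ p.1 p.2)
  have hYnn := nn_of (fun p => dθ Ψ p.1 p.2)
  have hXχnn := nn_of (fun p => χ p.1 p.2)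
  ----------------------------------------------------------------
  -- (b5)–(b8): the lower-order quantities in terms of `L₀ ≤ L`
  ----------------------------------------------------------------
  have hA : α ^ 2 * (∫ p in strip, p.1 ^ 2 * radialWeight p.1 ^ 2 * dz Ψ p.1 p.2 ^ 2 * Real.sin (2 * p.2) ^ (-eta)) ≤
      120 * ∫ p in strip, radialWeight p.1 ^ 2 * G p ^ 2 := by
    have e : ∫ p in strip, p.1 ^ 2 * radialWeight p.1 ^ 2 * dz (dθ Ψ) p.1 p.2 ^ 2 =
        ∫ p in strip, radialWeight p.1 ^ 2 * (p.1 * dz (dθ Ψ) p.1 p.2) ^ 2 := integral_congr_ae (ae_of_all _ fun p => by ring)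
    rw [e] at hB2
    linarith only [mul_le_mul_of_nonneg_left hB2 (sq_nonneg α), hS7]
  have hX1 : (∫ p in strip, radialWeight p.1 ^ 2 * Ψ p.1 p.2 ^ 2 * Real.sin (2 * p.2) ^ (-eta)) ≤
      10 * ∫ p in strip, radialWeight p.1 ^ 2 * G p ^ 2 := hB1.trans (by linarith only [hS1])
  have hπ2 : π ^ 2 < 98697 / 10000 := by
    have h1 := Real.pi_lt_d6; have h2 := Real.pi_pos
    norm_num at h1
    nlinarith [h1, h2]
  have hXχ : (∫ p in strip, radialWeight p.1 ^ 2 * χ p.1 p.2 ^ 2 * Real.sin (2 * p.2) ^ (-eta)) ≤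
      4748 * ∫ p in strip, radialWeight p.1 ^ 2 * G p ^ 2 := by
    have h400 : (4 : ℝ) / (1 - eta) = 400 := by norm_num [eta]
    have h50 : π ^ 2 / (2 * (1 - eta)) = 50 * π ^ 2 := by rw [eta]; norm_num; ring
    rw [h400, h50] at hB3
    have hQ0nn : 0 ≤ ∫ p in strip, radialWeight p.1 ^ 2 * dθ χ p.1 p.2 ^ 2 := integral_nonneg fun p => by positivity
    linarith only [hB3, hS4, hS8, mul_le_mul_of_nonneg_right hπ2.le hQ0nn, hQ0nn]
  have hY : (∫ p in strip, radialWeight p.1 ^ 2 * dθ Ψ p.1 p.2 ^ 2 * Real.sin (2 * p.2) ^ (-eta)) ≤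
      6322 * ∫ p in strip, radialWeight p.1 ^ 2 * G p ^ 2 := by
    have h400 : (4 : ℝ) / (1 - eta) = 400 := by norm_num [eta]
    have h50 : π ^ 2 / (2 * (1 - eta)) = 50 * π ^ 2 := by rw [eta]; norm_num; ring
    rw [h400, h50] at hB4
    have hP0nn : 0 ≤ ∫ p in strip, radialWeight p.1 ^ 2 * dθ (dθ Ψ) p.1 p.2 ^ 2 := integral_nonneg fun p => by positivity
    linarith only [hB4, hS1, hS3, mul_le_mul_of_nonneg_right hπ2.le hP0nn, hP0nn]
  ----------------------------------------------------------------
  -- Cauchy–Schwarz for the four cross terms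
  ----------------------------------------------------------------
  have hρ : ∀ᵐ p ∂(volume.restrict strip), 0 ≤ radialWeight p.1 ^ 2 * Real.sin (2 * p.2) ^ (-eta) := by
    rw [ae_restrict_iff' measurableSet_strip]
    exact Filter.Eventually.of_forall fun p hp => mul_nonneg (sq_nonneg _) (Real.rpow_nonneg (hsin p hp).le _)
  -- reshaping: `φ² ρ` forms
  have reshape : ∀ (φ ψ : ℝ × ℝ → ℝ), (fun p : ℝ × ℝ => φ p * ψ p * (radialWeight p.1 ^ 2 * Real.sin (2 * p.2) ^ (-eta))) =
      fun p => (radialWeight p.1 ^ 2 * (φ p * ψ p)) * Real.sin (2 * p.2) ^ (-eta) := fun φ ψ => funext fun p => by ring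
  have reshape2 : ∀ (φ : ℝ × ℝ → ℝ), (fun p : ℝ × ℝ => φ p ^ 2 * (radialWeight p.1 ^ 2 * Real.sin (2 * p.2) ^ (-eta))) =
      fun p => (radialWeight p.1 ^ 2 * φ p ^ 2) * Real.sin (2 * p.2) ^ (-eta) := fun φ => funext fun p => by ring
  -- integrability of `w²·g·u` for continuous compactly supported `g` vanishing for `R < a`
  have iW : ∀ (g : ℝ × ℝ → ℝ), Continuous g → HasCompactSupport g → (∀ p : ℝ × ℝ, p.1 < a → g p = 0) →
      IntegrableOn (fun p : ℝ × ℝ => (radialWeight p.1 ^ 2 * g p) * Real.sin (2 * p.2) ^ (-eta)) strip := by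
    intro g hg hgs hga
    exact int2 _ (cW_of g hg hga) (supp_of _ g hgs fun p hp => by simp [hp])
  -- the eight basic `ρ`-integrands (`ρ = w²u`)
  have iGG : IntegrableOn (fun p : ℝ × ℝ => G p ^ 2 * (radialWeight p.1 ^ 2 * Real.sin (2 * p.2) ^ (-eta))) strip :=
    (iW (fun p => G p ^ 2) (by fun_prop) (supp_of _ G sG fun p hp => by simp [hp]) fun p hp => by simp [hGa p hp]).congr
      (ae_of_all _ fun p => by ring)
  have iPP : IntegrableOn (fun p : ℝ × ℝ => (-dθ (dθ Ψ) p.1 p.2) ^ 2 * (radialWeight p.1 ^ 2 * Real.sin (2 * p.2) ^ (-eta))) strip :=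
    (iW (fun p => dθ (dθ Ψ) p.1 p.2 ^ 2) (by fun_prop) (supp_of _ _ hdθ2Ψs fun p hp => by simp [show dθ (dθ Ψ) p.1 p.2 = 0 from hp])
      fun p hp => by simp [hvadθ2 p hp]).congr (ae_of_all _ fun p => by ring)
  have iGP : IntegrableOn (fun p : ℝ × ℝ => G p * (-dθ (dθ Ψ) p.1 p.2) * (radialWeight p.1 ^ 2 * Real.sin (2 * p.2) ^ (-eta))) strip :=
    (iW (fun p => G p * (-dθ (dθ Ψ) p.1 p.2)) (by fun_prop) (supp_of _ G sG fun p hp => by simp [hp]) fun p hp => by simp [hGa p hp]).congr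
      (ae_of_all _ fun p => by ring)
  have iAA : IntegrableOn (fun p : ℝ × ℝ => (p.1 * dz Ψ p.1 p.2) ^ 2 * (radialWeight p.1 ^ 2 * Real.sin (2 * p.2) ^ (-eta))) strip :=
    (iW (fun p => (p.1 * dz Ψ p.1 p.2) ^ 2) (by fun_prop) (supp_of _ _ hdzΨs fun p hp => by simp [show dz Ψ p.1 p.2 = 0 from hp])
      fun p hp => by simp [hvadz p hp]).congr (ae_of_all _ fun p => by ring)
  have iAPabs : IntegrableOn (fun p : ℝ × ℝ => |p.1 * dz Ψ p.1 p.2| * |dθ (dθ Ψ) p.1 p.2| *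
      (radialWeight p.1 ^ 2 * Real.sin (2 * p.2) ^ (-eta))) strip :=
    (iW (fun p => |p.1 * dz Ψ p.1 p.2| * |dθ (dθ Ψ) p.1 p.2|) (by fun_prop)
      (supp_of _ _ hdzΨs fun p hp => by simp [show dz Ψ p.1 p.2 = 0 from hp]) fun p hp => by simp [hvadz p hp]).congr
      (ae_of_all _ fun p => by ring)
  have iAP : IntegrableOn (fun p : ℝ × ℝ => (p.1 * dz Ψ p.1 p.2) * dθ (dθ Ψ) p.1 p.2 *
      (radialWeight p.1 ^ 2 * Real.sin (2 * p.2) ^ (-eta))) strip :=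
    (iW (fun p => (p.1 * dz Ψ p.1 p.2) * dθ (dθ Ψ) p.1 p.2) (by fun_prop)
      (supp_of _ _ hdzΨs fun p hp => by simp [show dz Ψ p.1 p.2 = 0 from hp]) fun p hp => by simp [hvadz p hp]).congr
      (ae_of_all _ fun p => by ring)
  have iXX : IntegrableOn (fun p : ℝ × ℝ => Ψ p.1 p.2 ^ 2 * (radialWeight p.1 ^ 2 * Real.sin (2 * p.2) ^ (-eta))) strip :=
    (iW (fun p => Ψ p.1 p.2 ^ 2) (by fun_prop) (supp_of _ _ hΨs fun p hp => by simp [show Ψ p.1 p.2 = 0 from hp])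
      fun p hp => by simp [hvaΨ p hp]).congr (ae_of_all _ fun p => by ring)
  have iXP : IntegrableOn (fun p : ℝ × ℝ => Ψ p.1 p.2 * dθ (dθ Ψ) p.1 p.2 * (radialWeight p.1 ^ 2 * Real.sin (2 * p.2) ^ (-eta))) strip :=
    (iW (fun p => Ψ p.1 p.2 * dθ (dθ Ψ) p.1 p.2) (by fun_prop) (supp_of _ _ hΨs fun p hp => by simp [show Ψ p.1 p.2 = 0 from hp])
      fun p hp => by simp [hvaΨ p hp]).congr (ae_of_all _ fun p => by ring)
  have iPP' : IntegrableOn (fun p : ℝ × ℝ => dθ (dθ Ψ) p.1 p.2 ^ 2 * (radialWeight p.1 ^ 2 * Real.sin (2 * p.2) ^ (-eta))) strip :=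
    iPP.congr (ae_of_all _ fun p => by ring)
  -- the four Cauchy–Schwarz inequalities
  have hCS0 := sq_integral_mul_mul_le hρ iGG iPP iGP
  have hCS1 := sq_integral_mul_mul_le (φ := fun p : ℝ × ℝ => |p.1 * dz Ψ p.1 p.2|) (ψ := fun p => |dθ (dθ Ψ) p.1 p.2|) hρ
    (iAA.congr (ae_of_all _ fun p => by simp only [sq_abs])) (iPP'.congr (ae_of_all _ fun p => by simp only [sq_abs])) iAPabs
  have hCS2 := sq_integral_mul_mul_le hρ iAA iPP' iAP
  have hCS3 := sq_integral_mul_mul_le hρ iXX iPP' iXP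
  simp only [sq_abs, neg_sq] at hCS0 hCS1 hCS2 hCS3
  -- name the integrals appearing in the identity (after reshaping to the `ρ`-forms)
  have rI0 : ∫ p in strip, ellipticOp α Ψ p.1 p.2 * (-dθ (dθ Ψ) p.1 p.2) * radialWeight p.1 ^ 2 * Real.sin (2 * p.2) ^ (-eta) =
      ∫ p in strip, G p * (-dθ (dθ Ψ) p.1 p.2) * (radialWeight p.1 ^ 2 * Real.sin (2 * p.2) ^ (-eta)) :=
    setIntegral_congr_fun measurableSet_strip fun p hp => by rw [hFG p hp]; ring
  have rL : ∫ p in strip, radialWeight p.1 ^ 2 * G p ^ 2 * Real.sin (2 * p.2) ^ (-eta) =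
      ∫ p in strip, G p ^ 2 * (radialWeight p.1 ^ 2 * Real.sin (2 * p.2) ^ (-eta)) := integral_congr_ae (ae_of_all _ fun p => by ring)
  have rP : ∫ p in strip, radialWeight p.1 ^ 2 * dθ (dθ Ψ) p.1 p.2 ^ 2 * Real.sin (2 * p.2) ^ (-eta) =
      ∫ p in strip, dθ (dθ Ψ) p.1 p.2 ^ 2 * (radialWeight p.1 ^ 2 * Real.sin (2 * p.2) ^ (-eta)) := integral_congr_ae (ae_of_all _ fun p => by ring)
  have rA : ∫ p in strip, p.1 ^ 2 * radialWeight p.1 ^ 2 * dz Ψ p.1 p.2 ^ 2 * Real.sin (2 * p.2) ^ (-eta) =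
      ∫ p in strip, (p.1 * dz Ψ p.1 p.2) ^ 2 * (radialWeight p.1 ^ 2 * Real.sin (2 * p.2) ^ (-eta)) := integral_congr_ae (ae_of_all _ fun p => by ring)
  have rB : ∫ p in strip, radialWeight p.1 ^ 2 * (p.1 * dz Ψ p.1 p.2) * dθ (dθ Ψ) p.1 p.2 * Real.sin (2 * p.2) ^ (-eta) =
      ∫ p in strip, (p.1 * dz Ψ p.1 p.2) * dθ (dθ Ψ) p.1 p.2 * (radialWeight p.1 ^ 2 * Real.sin (2 * p.2) ^ (-eta)) :=
    integral_congr_ae (ae_of_all _ fun p => by ring)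
  have rX : ∫ p in strip, radialWeight p.1 ^ 2 * Ψ p.1 p.2 ^ 2 * Real.sin (2 * p.2) ^ (-eta) =
      ∫ p in strip, Ψ p.1 p.2 ^ 2 * (radialWeight p.1 ^ 2 * Real.sin (2 * p.2) ^ (-eta)) := integral_congr_ae (ae_of_all _ fun p => by ring)
  have rE : ∫ p in strip, radialWeight p.1 ^ 2 * Ψ p.1 p.2 * dθ (dθ Ψ) p.1 p.2 * Real.sin (2 * p.2) ^ (-eta) =
      ∫ p in strip, Ψ p.1 p.2 * dθ (dθ Ψ) p.1 p.2 * (radialWeight p.1 ^ 2 * Real.sin (2 * p.2) ^ (-eta)) :=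
    integral_congr_ae (ae_of_all _ fun p => by ring)
  rw [rI0, rA, rB, rE, rX, rP] at hId
  rw [rA] at hA hAnn
  rw [rX] at hX1 hX1nn
  rw [rP] at hPnn
  rw [rL] at hL0L hLnn ⊢
  have hA4nn : 0 ≤ ∫ p in strip, p.1 ^ 2 * radialWeight p.1 ^ 2 * Real.cos (2 * p.2) ^ 2 * (dz Ψ p.1 p.2 / Real.sin (2 * p.2)) ^ 2 *
      Real.sin (2 * p.2) ^ (-eta) :=
    setIntegral_nonneg measurableSet_strip fun p hp => mul_nonneg (by positivity) (Real.rpow_nonneg (hsin p hp).le _)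
  have hX4nn : 0 ≤ ∫ p in strip, radialWeight p.1 ^ 2 * Real.cos (2 * p.2) ^ 2 * (Ψ p.1 p.2 / Real.sin (2 * p.2)) ^ 2 *
      Real.sin (2 * p.2) ^ (-eta) :=
    setIntegral_nonneg measurableSet_strip fun p hp => mul_nonneg (by positivity) (Real.rpow_nonneg (hsin p hp).le _)
  rw [rA, rX, rP]
  ----------------------------------------------------------------
  -- (b2): the radial-derivative-of-the-weight term
  ----------------------------------------------------------------
  have hM'c : ContinuousOn (deriv fun R : ℝ => R ^ 2 * radialWeight R ^ 2) (Ioi 0) :=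
    ((contDiffOn_sq_mul_radialWeight_sq (n := 2)).deriv_of_isOpen (m := 1) isOpen_Ioi (by norm_num)).continuousOn
  have cT1 : Continuous fun p : ℝ × ℝ => deriv (fun R : ℝ => R ^ 2 * radialWeight R ^ 2) p.1 * (dz Ψ p.1 p.2 * dθ (dθ Ψ) p.1 p.2) :=
    continuous_weight_mul₂ hM'c (cdz.mul cdθ2) ha fun p hp => by simp [hvadz p hp]
  have sT1 : HasCompactSupport fun p : ℝ × ℝ => deriv (fun R : ℝ => R ^ 2 * radialWeight R ^ 2) p.1 * (dz Ψ p.1 p.2 * dθ (dθ Ψ) p.1 p.2) :=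
    supp_of _ _ hdzΨs fun p hp => by simp [show dz Ψ p.1 p.2 = 0 from hp]
  have iT1 : IntegrableOn (fun p : ℝ × ℝ => deriv (fun R : ℝ => R ^ 2 * radialWeight R ^ 2) p.1 * dz Ψ p.1 p.2 * dθ (dθ Ψ) p.1 p.2 *
      Real.sin (2 * p.2) ^ (-eta)) strip := (int2 _ cT1 sT1).congr (ae_of_all _ fun p => by ring)
  have hT1abs : |∫ p in strip, deriv (fun R : ℝ => R ^ 2 * radialWeight R ^ 2) p.1 * dz Ψ p.1 p.2 * dθ (dθ Ψ) p.1 p.2 *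
      Real.sin (2 * p.2) ^ (-eta)| ≤ 2 * ∫ p in strip, |p.1 * dz Ψ p.1 p.2| * |dθ (dθ Ψ) p.1 p.2| *
        (radialWeight p.1 ^ 2 * Real.sin (2 * p.2) ^ (-eta)) := by
    refine (MeasureTheory.abs_integral_le_integral_abs).trans ?_
    rw [← MeasureTheory.integral_const_mul]
    refine setIntegral_mono_on iT1.abs (iAPabs.const_mul _) measurableSet_strip fun p hp => ?_
    have hu : 0 ≤ Real.sin (2 * p.2) ^ (-eta) := Real.rpow_nonneg (hsin p hp).le _
    have hM' := abs_deriv_sq_mul_radialWeight_sq_le hp.1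
    rw [abs_mul, abs_mul, abs_mul, abs_of_nonneg hu]
    have e : 2 * (|p.1 * dz Ψ p.1 p.2| * |dθ (dθ Ψ) p.1 p.2| * (radialWeight p.1 ^ 2 * Real.sin (2 * p.2) ^ (-eta))) =
        (2 * p.1 * radialWeight p.1 ^ 2) * |dz Ψ p.1 p.2| * |dθ (dθ Ψ) p.1 p.2| * Real.sin (2 * p.2) ^ (-eta) := by
      rw [abs_mul, abs_of_pos hp.1]; ring
    rw [e]
    have : |deriv (fun R : ℝ => R ^ 2 * radialWeight R ^ 2) p.1| * |dz Ψ p.1 p.2| * |dθ (dθ Ψ) p.1 p.2| ≤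
        (2 * p.1 * radialWeight p.1 ^ 2) * |dz Ψ p.1 p.2| * |dθ (dθ Ψ) p.1 p.2| :=
      mul_le_mul_of_nonneg_right (mul_le_mul_of_nonneg_right hM' (abs_nonneg _)) (abs_nonneg _)
    exact mul_le_mul_of_nonneg_right this hu
  ----------------------------------------------------------------
  -- the remaining lower-order pieces of the identity
  ----------------------------------------------------------------
  -- `X2' : |∫ w² c χ² u| ≤ ∫ w² χ² u`
  have iXχ : IntegrableOn (fun p : ℝ × ℝ => radialWeight p.1 ^ 2 * χ p.1 p.2 ^ 2 * Real.sin (2 * p.2) ^ (-eta)) strip :=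
    iW (fun p => χ p.1 p.2 ^ 2) (by fun_prop) (supp_of _ _ hs fun p hp => by simp [show χ p.1 p.2 = 0 from hp]) fun p hp => by simp [hvaχ p hp]
  have iXcχ : IntegrableOn (fun p : ℝ × ℝ => radialWeight p.1 ^ 2 * Real.cos (2 * p.2) * χ p.1 p.2 ^ 2 * Real.sin (2 * p.2) ^ (-eta)) strip :=
    (iW (fun p => Real.cos (2 * p.2) * χ p.1 p.2 ^ 2) (by fun_prop) (supp_of _ _ hs fun p hp => by simp [show χ p.1 p.2 = 0 from hp])
      fun p hp => by simp [hvaχ p hp]).congr (ae_of_all _ fun p => by ring)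
  have hX2abs : |∫ p in strip, radialWeight p.1 ^ 2 * Real.cos (2 * p.2) * χ p.1 p.2 ^ 2 * Real.sin (2 * p.2) ^ (-eta)| ≤
      ∫ p in strip, radialWeight p.1 ^ 2 * χ p.1 p.2 ^ 2 * Real.sin (2 * p.2) ^ (-eta) := by
    refine (MeasureTheory.abs_integral_le_integral_abs).trans (setIntegral_mono_on iXcχ.abs iXχ measurableSet_strip fun p hp => ?_)
    have hu : 0 ≤ Real.sin (2 * p.2) ^ (-eta) := Real.rpow_nonneg (hsin p hp).le _
    rw [abs_mul, abs_mul, abs_mul, abs_of_nonneg hu, abs_of_nonneg (sq_nonneg (radialWeight p.1)), abs_of_nonneg (sq_nonneg (χ p.1 p.2))]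
    have hc := Real.abs_cos_le_one (2 * p.2)
    have : radialWeight p.1 ^ 2 * |Real.cos (2 * p.2)| * χ p.1 p.2 ^ 2 ≤ radialWeight p.1 ^ 2 * 1 * χ p.1 p.2 ^ 2 :=
      mul_le_mul_of_nonneg_right (mul_le_mul_of_nonneg_left hc (sq_nonneg _)) (sq_nonneg _)
    nlinarith [mul_le_mul_of_nonneg_right this hu]
  -- `Q' ≥ Q₁ = ∫ w² u (∂_θχ)²` (the coefficient `q ≥ 1`)
  have iQ1 : IntegrableOn (fun p : ℝ × ℝ => radialWeight p.1 ^ 2 * dθ χ p.1 p.2 ^ 2 * Real.sin (2 * p.2) ^ (-eta)) strip :=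
    iW (fun p => dθ χ p.1 p.2 ^ 2) (by fun_prop) (supp_of _ _ hdθχs fun p hp => by simp [show dθ χ p.1 p.2 = 0 from hp]) fun p hp => by simp [hvadθχ p hp]
  have iQ : IntegrableOn (fun p : ℝ × ℝ => radialWeight p.1 ^ 2 * (Real.cos p.2 ^ 2 + 2 * Real.sin p.2 ^ 2 + (1 / 2) * (1 - eta) * Real.cos (2 * p.2)) *
      dθ χ p.1 p.2 ^ 2 * Real.sin (2 * p.2) ^ (-eta)) strip :=
    (iW (fun p => (Real.cos p.2 ^ 2 + 2 * Real.sin p.2 ^ 2 + (1 / 2) * (1 - eta) * Real.cos (2 * p.2)) * dθ χ p.1 p.2 ^ 2) (by fun_prop)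
      (supp_of _ _ hdθχs fun p hp => by simp [show dθ χ p.1 p.2 = 0 from hp]) fun p hp => by simp [hvadθχ p hp]).congr
      (ae_of_all _ fun p => by ring)
  have hQ1le : (∫ p in strip, radialWeight p.1 ^ 2 * dθ χ p.1 p.2 ^ 2 * Real.sin (2 * p.2) ^ (-eta)) ≤
      ∫ p in strip, radialWeight p.1 ^ 2 * (Real.cos p.2 ^ 2 + 2 * Real.sin p.2 ^ 2 + (1 / 2) * (1 - eta) * Real.cos (2 * p.2)) *
        dθ χ p.1 p.2 ^ 2 * Real.sin (2 * p.2) ^ (-eta) := by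
    refine setIntegral_mono_on iQ1 iQ measurableSet_strip fun p hp => ?_
    have hu : 0 ≤ Real.sin (2 * p.2) ^ (-eta) := Real.rpow_nonneg (hsin p hp).le _
    have hq : 1 ≤ Real.cos p.2 ^ 2 + 2 * Real.sin p.2 ^ 2 + (1 / 2) * (1 - eta) * Real.cos (2 * p.2) := by
      have h1 := Real.sin_sq_add_cos_sq p.2
      have h2 := Real.cos_two_mul p.2
      have h3 : (1 / 2 : ℝ) * (1 - eta) = 1 / 200 := by rw [heta]; norm_num
      rw [h3, h2]
      linarith [sq_nonneg (Real.sin p.2), sq_nonneg (Real.cos p.2), h1]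
    have hnn : 0 ≤ radialWeight p.1 ^ 2 * dθ χ p.1 p.2 ^ 2 * Real.sin (2 * p.2) ^ (-eta) := by positivity
    calc radialWeight p.1 ^ 2 * dθ χ p.1 p.2 ^ 2 * Real.sin (2 * p.2) ^ (-eta)
        = 1 * (radialWeight p.1 ^ 2 * dθ χ p.1 p.2 ^ 2 * Real.sin (2 * p.2) ^ (-eta)) := by ring
      _ ≤ (Real.cos p.2 ^ 2 + 2 * Real.sin p.2 ^ 2 + (1 / 2) * (1 - eta) * Real.cos (2 * p.2)) *
          (radialWeight p.1 ^ 2 * dθ χ p.1 p.2 ^ 2 * Real.sin (2 * p.2) ^ (-eta)) := mul_le_mul_of_nonneg_right hq hnn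
      _ = _ := by ring
  ----------------------------------------------------------------
  -- (h-prep): the radial second derivatives by difference (integral form)
  ----------------------------------------------------------------
  have hpt : ∀ p ∈ strip, radialWeight p.1 ^ 2 * (α ^ 2 * (p.1 ^ 2 * dz (dz Ψ) p.1 p.2)) ^ 2 * Real.sin (2 * p.2) ^ (-eta) ≤
      6 * (G p ^ 2 * (radialWeight p.1 ^ 2 * Real.sin (2 * p.2) ^ (-eta)) +
        36 * (α ^ 2 * ((p.1 * dz Ψ p.1 p.2) ^ 2 * (radialWeight p.1 ^ 2 * Real.sin (2 * p.2) ^ (-eta)))) +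
        dθ (dθ Ψ) p.1 p.2 ^ 2 * (radialWeight p.1 ^ 2 * Real.sin (2 * p.2) ^ (-eta)) +
        radialWeight p.1 ^ 2 * χ p.1 p.2 ^ 2 * Real.sin (2 * p.2) ^ (-eta) +
        radialWeight p.1 ^ 2 * dθ χ p.1 p.2 ^ 2 * Real.sin (2 * p.2) ^ (-eta) +
        36 * (Ψ p.1 p.2 ^ 2 * (radialWeight p.1 ^ 2 * Real.sin (2 * p.2) ^ (-eta)))) := by
    intro p hp
    have hu : 0 ≤ Real.sin (2 * p.2) ^ (-eta) := Real.rpow_nonneg (hsin p hp).le _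
    have e : α ^ 2 * (p.1 ^ 2 * dz (dz Ψ) p.1 p.2) = -G p + -(α * (5 + α) * (p.1 * dz Ψ p.1 p.2)) + -dθ (dθ Ψ) p.1 p.2 +
        Real.cos p.2 * χ p.1 p.2 + Real.sin p.2 * dθ χ p.1 p.2 + -(6 * Ψ p.1 p.2) := by
      rw [hG]; ring
    rw [e]
    have h := radial_pointwise_bound hα.le hα1 (Real.cos_sq_le_one p.2) (Real.sin_sq_le_one p.2) (G p) (p.1 * dz Ψ p.1 p.2)
      (dθ (dθ Ψ) p.1 p.2) (χ p.1 p.2) (dθ χ p.1 p.2) (Ψ p.1 p.2)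
    have hw := mul_nonneg (sq_nonneg (radialWeight p.1)) hu
    have := mul_le_mul_of_nonneg_left h hw
    calc radialWeight p.1 ^ 2 * (-G p + -(α * (5 + α) * (p.1 * dz Ψ p.1 p.2)) + -dθ (dθ Ψ) p.1 p.2 + Real.cos p.2 * χ p.1 p.2 +
          Real.sin p.2 * dθ χ p.1 p.2 + -(6 * Ψ p.1 p.2)) ^ 2 * Real.sin (2 * p.2) ^ (-eta)
        = radialWeight p.1 ^ 2 * Real.sin (2 * p.2) ^ (-eta) * (-G p + -(α * (5 + α) * (p.1 * dz Ψ p.1 p.2)) + -dθ (dθ Ψ) p.1 p.2 +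
            Real.cos p.2 * χ p.1 p.2 + Real.sin p.2 * dθ χ p.1 p.2 + -(6 * Ψ p.1 p.2)) ^ 2 := by ring
      _ ≤ radialWeight p.1 ^ 2 * Real.sin (2 * p.2) ^ (-eta) * (6 * (G p ^ 2 + 36 * (α ^ 2 * (p.1 * dz Ψ p.1 p.2) ^ 2) +
            dθ (dθ Ψ) p.1 p.2 ^ 2 + χ p.1 p.2 ^ 2 + dθ χ p.1 p.2 ^ 2 + 36 * Ψ p.1 p.2 ^ 2)) := this
      _ = _ := by ring
  have iLHS : IntegrableOn (fun p : ℝ × ℝ => radialWeight p.1 ^ 2 * (α ^ 2 * (p.1 ^ 2 * dz (dz Ψ) p.1 p.2)) ^ 2 * Real.sin (2 * p.2) ^ (-eta)) strip :=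
    (iW (fun p => (α ^ 2 * (p.1 ^ 2 * dz (dz Ψ) p.1 p.2)) ^ 2) (by fun_prop)
      (supp_of _ _ hdz2Ψs fun p hp => by simp [show dz (dz Ψ) p.1 p.2 = 0 from hp]) fun p hp => by simp [hvadz2 p hp]).congr
      (ae_of_all _ fun p => by ring)
  have k1 : IntegrableOn (fun p : ℝ × ℝ => G p ^ 2 * (radialWeight p.1 ^ 2 * Real.sin (2 * p.2) ^ (-eta)) +
      36 * (α ^ 2 * ((p.1 * dz Ψ p.1 p.2) ^ 2 * (radialWeight p.1 ^ 2 * Real.sin (2 * p.2) ^ (-eta))))) strip :=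
    iGG.add ((iAA.const_mul _).const_mul _)
  have k2 : IntegrableOn (fun p : ℝ × ℝ => G p ^ 2 * (radialWeight p.1 ^ 2 * Real.sin (2 * p.2) ^ (-eta)) +
      36 * (α ^ 2 * ((p.1 * dz Ψ p.1 p.2) ^ 2 * (radialWeight p.1 ^ 2 * Real.sin (2 * p.2) ^ (-eta)))) +
      dθ (dθ Ψ) p.1 p.2 ^ 2 * (radialWeight p.1 ^ 2 * Real.sin (2 * p.2) ^ (-eta))) strip := k1.add iPP'
  have k3 : IntegrableOn (fun p : ℝ × ℝ => G p ^ 2 * (radialWeight p.1 ^ 2 * Real.sin (2 * p.2) ^ (-eta)) +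
      36 * (α ^ 2 * ((p.1 * dz Ψ p.1 p.2) ^ 2 * (radialWeight p.1 ^ 2 * Real.sin (2 * p.2) ^ (-eta)))) +
      dθ (dθ Ψ) p.1 p.2 ^ 2 * (radialWeight p.1 ^ 2 * Real.sin (2 * p.2) ^ (-eta)) +
      radialWeight p.1 ^ 2 * χ p.1 p.2 ^ 2 * Real.sin (2 * p.2) ^ (-eta)) strip := k2.add iXχ
  have k4 : IntegrableOn (fun p : ℝ × ℝ => G p ^ 2 * (radialWeight p.1 ^ 2 * Real.sin (2 * p.2) ^ (-eta)) +
      36 * (α ^ 2 * ((p.1 * dz Ψ p.1 p.2) ^ 2 * (radialWeight p.1 ^ 2 * Real.sin (2 * p.2) ^ (-eta)))) +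
      dθ (dθ Ψ) p.1 p.2 ^ 2 * (radialWeight p.1 ^ 2 * Real.sin (2 * p.2) ^ (-eta)) +
      radialWeight p.1 ^ 2 * χ p.1 p.2 ^ 2 * Real.sin (2 * p.2) ^ (-eta) +
      radialWeight p.1 ^ 2 * dθ χ p.1 p.2 ^ 2 * Real.sin (2 * p.2) ^ (-eta)) strip := k3.add iQ1
  have k5 : IntegrableOn (fun p : ℝ × ℝ => 36 * (Ψ p.1 p.2 ^ 2 * (radialWeight p.1 ^ 2 * Real.sin (2 * p.2) ^ (-eta)))) strip := iXX.const_mul _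
  have kA : IntegrableOn (fun p : ℝ × ℝ => 36 * (α ^ 2 * ((p.1 * dz Ψ p.1 p.2) ^ 2 * (radialWeight p.1 ^ 2 * Real.sin (2 * p.2) ^ (-eta))))) strip :=
    (iAA.const_mul _).const_mul _
  have iRHS : IntegrableOn (fun p : ℝ × ℝ => 6 * (G p ^ 2 * (radialWeight p.1 ^ 2 * Real.sin (2 * p.2) ^ (-eta)) +
      36 * (α ^ 2 * ((p.1 * dz Ψ p.1 p.2) ^ 2 * (radialWeight p.1 ^ 2 * Real.sin (2 * p.2) ^ (-eta)))) +
      dθ (dθ Ψ) p.1 p.2 ^ 2 * (radialWeight p.1 ^ 2 * Real.sin (2 * p.2) ^ (-eta)) +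
      radialWeight p.1 ^ 2 * χ p.1 p.2 ^ 2 * Real.sin (2 * p.2) ^ (-eta) +
      radialWeight p.1 ^ 2 * dθ χ p.1 p.2 ^ 2 * Real.sin (2 * p.2) ^ (-eta) +
      36 * (Ψ p.1 p.2 ^ 2 * (radialWeight p.1 ^ 2 * Real.sin (2 * p.2) ^ (-eta))))) strip := (k4.add k5).const_mul _
  have hmono := setIntegral_mono_on iLHS iRHS measurableSet_strip hpt
  rw [MeasureTheory.integral_const_mul, integral_add k4 k5, integral_add k3 iQ1, integral_add k2 iXχ, integral_add k1 iPP',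
    integral_add iGG kA, MeasureTheory.integral_const_mul, MeasureTheory.integral_const_mul, MeasureTheory.integral_const_mul] at hmono
  have eLHS : ∫ p in strip, radialWeight p.1 ^ 2 * (α ^ 2 * (p.1 ^ 2 * dz (dz Ψ) p.1 p.2)) ^ 2 * Real.sin (2 * p.2) ^ (-eta) =
      α ^ 4 * ∫ p in strip, radialWeight p.1 ^ 2 * (p.1 ^ 2 * dz (dz Ψ) p.1 p.2) ^ 2 * Real.sin (2 * p.2) ^ (-eta) := by
    rw [← MeasureTheory.integral_const_mul]
    exact integral_congr_ae (ae_of_all _ fun p => by ring)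
  rw [eLHS] at hmono
  ----------------------------------------------------------------
  -- name the quantities
  ----------------------------------------------------------------
  obtain ⟨Lq, hLq⟩ : ∃ x : ℝ, x = ∫ p in strip, G p ^ 2 * (radialWeight p.1 ^ 2 * Real.sin (2 * p.2) ^ (-eta)) := ⟨_, rfl⟩
  obtain ⟨L0q, hL0q⟩ : ∃ x : ℝ, x = ∫ p in strip, radialWeight p.1 ^ 2 * G p ^ 2 := ⟨_, rfl⟩
  obtain ⟨Pq, hPq⟩ : ∃ x : ℝ, x = ∫ p in strip, dθ (dθ Ψ) p.1 p.2 ^ 2 * (radialWeight p.1 ^ 2 * Real.sin (2 * p.2) ^ (-eta)) := ⟨_, rfl⟩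
  obtain ⟨Zq, hZq⟩ : ∃ x : ℝ, x = ∫ p in strip, p.1 ^ 2 * radialWeight p.1 ^ 2 * dz (dθ Ψ) p.1 p.2 ^ 2 * Real.sin (2 * p.2) ^ (-eta) := ⟨_, rfl⟩
  obtain ⟨Aq, hAq⟩ : ∃ x : ℝ, x = ∫ p in strip, (p.1 * dz Ψ p.1 p.2) ^ 2 * (radialWeight p.1 ^ 2 * Real.sin (2 * p.2) ^ (-eta)) := ⟨_, rfl⟩
  obtain ⟨Bq, hBq⟩ : ∃ x : ℝ, x = ∫ p in strip, (p.1 * dz Ψ p.1 p.2) * dθ (dθ Ψ) p.1 p.2 * (radialWeight p.1 ^ 2 * Real.sin (2 * p.2) ^ (-eta)) :=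
    ⟨_, rfl⟩
  obtain ⟨Eq', hEq⟩ : ∃ x : ℝ, x = ∫ p in strip, Ψ p.1 p.2 * dθ (dθ Ψ) p.1 p.2 * (radialWeight p.1 ^ 2 * Real.sin (2 * p.2) ^ (-eta)) := ⟨_, rfl⟩
  obtain ⟨X1q, hX1q⟩ : ∃ x : ℝ, x = ∫ p in strip, Ψ p.1 p.2 ^ 2 * (radialWeight p.1 ^ 2 * Real.sin (2 * p.2) ^ (-eta)) := ⟨_, rfl⟩
  obtain ⟨T1q, hT1q⟩ : ∃ x : ℝ, x = ∫ p in strip, deriv (fun R : ℝ => R ^ 2 * radialWeight R ^ 2) p.1 * dz Ψ p.1 p.2 * dθ (dθ Ψ) p.1 p.2 *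
      Real.sin (2 * p.2) ^ (-eta) := ⟨_, rfl⟩
  obtain ⟨A4q, hA4q⟩ : ∃ x : ℝ, x = ∫ p in strip, p.1 ^ 2 * radialWeight p.1 ^ 2 * Real.cos (2 * p.2) ^ 2 *
      (dz Ψ p.1 p.2 / Real.sin (2 * p.2)) ^ 2 * Real.sin (2 * p.2) ^ (-eta) := ⟨_, rfl⟩
  obtain ⟨Xcq, hXcq⟩ : ∃ x : ℝ, x = ∫ p in strip, radialWeight p.1 ^ 2 * Real.cos (2 * p.2) * χ p.1 p.2 ^ 2 * Real.sin (2 * p.2) ^ (-eta) := ⟨_, rfl⟩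
  obtain ⟨X4q, hX4q⟩ : ∃ x : ℝ, x = ∫ p in strip, radialWeight p.1 ^ 2 * Real.cos (2 * p.2) ^ 2 * (Ψ p.1 p.2 / Real.sin (2 * p.2)) ^ 2 *
      Real.sin (2 * p.2) ^ (-eta) := ⟨_, rfl⟩
  obtain ⟨Yq, hYq⟩ : ∃ x : ℝ, x = ∫ p in strip, radialWeight p.1 ^ 2 * dθ Ψ p.1 p.2 ^ 2 * Real.sin (2 * p.2) ^ (-eta) := ⟨_, rfl⟩
  obtain ⟨Xχq, hXχq⟩ : ∃ x : ℝ, x = ∫ p in strip, radialWeight p.1 ^ 2 * χ p.1 p.2 ^ 2 * Real.sin (2 * p.2) ^ (-eta) := ⟨_, rfl⟩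
  obtain ⟨Qq, hQq⟩ : ∃ x : ℝ, x = ∫ p in strip, radialWeight p.1 ^ 2 * (Real.cos p.2 ^ 2 + 2 * Real.sin p.2 ^ 2 +
      (1 / 2) * (1 - eta) * Real.cos (2 * p.2)) * dθ χ p.1 p.2 ^ 2 * Real.sin (2 * p.2) ^ (-eta) := ⟨_, rfl⟩
  obtain ⟨Q1q, hQ1q⟩ : ∃ x : ℝ, x = ∫ p in strip, radialWeight p.1 ^ 2 * dθ χ p.1 p.2 ^ 2 * Real.sin (2 * p.2) ^ (-eta) := ⟨_, rfl⟩
  obtain ⟨Jq, hJq⟩ : ∃ x : ℝ, x = ∫ p in strip, |p.1 * dz Ψ p.1 p.2| * |dθ (dθ Ψ) p.1 p.2| *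
      (radialWeight p.1 ^ 2 * Real.sin (2 * p.2) ^ (-eta)) := ⟨_, rfl⟩
  obtain ⟨I0q, hI0q⟩ : ∃ x : ℝ, x = ∫ p in strip, G p * (-dθ (dθ Ψ) p.1 p.2) * (radialWeight p.1 ^ 2 * Real.sin (2 * p.2) ^ (-eta)) := ⟨_, rfl⟩
  obtain ⟨RRq, hRRq⟩ : ∃ x : ℝ, x = ∫ p in strip, radialWeight p.1 ^ 2 * (p.1 ^ 2 * dz (dz Ψ) p.1 p.2) ^ 2 * Real.sin (2 * p.2) ^ (-eta) := ⟨_, rfl⟩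
  -- restate everything in the names
  have nId : I0q = α ^ 2 * (-T1q + Zq - 2 * eta * Aq - 2 * eta * (1 + eta) * A4q) + α * (5 + α) * Bq + Pq +
      ((1 - 2 * eta) * X1q - (1 / 2) * (1 + eta) * Xcq + Qq - 2 * eta * (1 + eta) * X4q) + 6 * Eq' := by
    rw [hI0q, hT1q, hZq, hAq, hA4q, hBq, hPq, hX1q, hXcq, hQq, hX4q, hEq]; exact hId
  have nCS0 : I0q ^ 2 ≤ Lq * Pq := by rw [hI0q, hLq, hPq]; exact hCS0
  have nCS1 : Jq ^ 2 ≤ Aq * Pq := by rw [hJq, hAq, hPq]; exact hCS1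
  have nCS2 : Bq ^ 2 ≤ Aq * Pq := by rw [hBq, hAq, hPq]; exact hCS2
  have nCS3 : Eq' ^ 2 ≤ X1q * Pq := by rw [hEq, hX1q, hPq]; exact hCS3
  have nT1 : |T1q| ≤ 2 * Jq := by rw [hT1q, hJq]; exact hT1abs
  have nA : α ^ 2 * Aq ≤ 120 * L0q := by rw [hAq, hL0q]; exact hA
  have nX1 : X1q ≤ 10 * L0q := by rw [hX1q, hL0q]; exact hX1
  have nXχ : Xχq ≤ 4748 * L0q := by rw [hXχq, hL0q]; exact hXχ
  have nY : Yq ≤ 6322 * L0q := by rw [hYq, hL0q]; exact hY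
  have nB5 : (1 + eta) ^ 2 * A4q ≤ Zq := by rw [hA4q, hZq]; exact hB5
  have nB6 : (1 + eta) ^ 2 * X4q ≤ Yq := by rw [hX4q, hYq]; exact hB6
  have nX2 : |Xcq| ≤ Xχq := by rw [hXcq, hXχq]; exact hX2abs
  have nQ1 : Q1q ≤ Qq := by rw [hQ1q, hQq]; exact hQ1le
  have nL0L : L0q ≤ Lq := by rw [hL0q, hLq]; exact hL0L
  have nLnn : 0 ≤ Lq := by rw [hLq]; exact hLnn
  have nPnn : 0 ≤ Pq := by rw [hPq]; exact hPnn
  have nZnn : 0 ≤ Zq := by rw [hZq]; exact hZnn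
  have nX4nn : 0 ≤ X4q := by rw [hX4q]; exact hX4nn
  have nQ1nn : 0 ≤ Q1q := by rw [hQ1q]; exact hQ1nn
  have nmono : α ^ 4 * RRq ≤ 6 * (Lq + 36 * (α ^ 2 * Aq) + Pq + Xχq + Q1q + 36 * X1q) := by
    rw [hRRq, hLq, hAq, hPq, hXχq, hQ1q, hX1q]; exact hmono
  -- rewrite the goal in the names
  rw [← hLq, ← hPq, ← hZq, ← hQ1q, ← hAq, ← hX1q, ← hXχq, ← hYq, ← hRRq]
  exact step2_final heta hα hα4 nId nCS0 nCS1 nCS2 nCS3 nT1 nA nX1 nXχ nY nB5 nB6 nX2 nQ1 nL0L nLnn nPnn nZnn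
    nX4nn nQ1nn nmono

end Elgindi

end Literature.Analysis.FluidPDE
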